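import Mathlib
import HarnessLib
import Summits.FinalStateConjecture.Statement
import Literature.Geometry.Lorentzian.ReggeWheelerTortoise
import Literature.Geometry.Lorentzian.ReggeWheelerChannels
import Summits.FinalStateConjecture.FinalStateConjecture.Theorems.PhotonSphereChannelsAssemblyFrameT2
import Summits.FinalStateConjecture.FinalStateConjecture.Theorems.PhotonSphereChannelsUniformPhotonSphereChannelsR

/-!
# Route PhotonSphereChannels — the repaired Assembly, frame form (item stmt-FinalStateConjecture-14078) — RETIRED

This module closed the rev-7 assembly item stmt-FinalStateConjecture-14078 of route `PhotonSphereChannels`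
(2026-08-16T05:49Z): the uncurried frame `(K1R ∧ K2R ∧ K3) → FinalStateConjecture` with K1R =
`UniformPhotonSphereChannelsR` (log-ball two-ended channel-of-energy inequality for the Regge–Wheeler
family), K2R = `ChannelsResolveTameDevelopmentsR` in its rev-7 form (consequent `∃ O d, O = exteriorOf 𝒟
d.charted ∧ HasExhaustiveCharts d`) and K3 = `TameCensorship` in its rev-7 form (over the topology-free
`IsChristodoulouGeneric`), all three inlined verbatim, proved by pure logic against the then summit
statement.

Record (2026-08-16, dependency-drift repair = this revision).  At 21:18Z the summit statement
`FinalStateConjecture` was RE-TYPED (semantic-vacuity audit, re-type T2: TAME genericity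
`IsTameChristodoulouGeneric` on one fixed end, and the extra conclusion conjuncts `RaysStayInClosure`,
`IsFutureOriented`); the route was repaired at rev 15 (K2R and K3 restated in place with the T2 consequent /
tame genericity; the assembly re-keyed as stmt-FinalStateConjecture-17432 and closed by
`PhotonSphereChannels.assemblyT2_frame_proof`, `Theorems/PhotonSphereChannelsAssemblyFrameT2.lean`), and the
route file dropped this module from its imports.  Against the re-typed statement the rev-7 frame is no
longer a theorem of logic — the rev-7 K2R/K3 do not produce tame witness families, `RaysStayInClosure` or
`IsFutureOriented` — and, its first conjunct K1R being PROVED (`uniformPhotonSphereChannelsR_proof`), it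
cannot be closed vacuously either (unlike the rev-5 frame `PhotonSphereChannelsAssemblyFrame.lean`, whose
first conjunct is the refuted K1).  The landed
name is therefore kept as a DEPRECATED ALIAS (`@[deprecated] alias`) of the survivor
`PhotonSphereChannels.assemblyT2_frame_proof`, whose type is the T2 frame (δ-equal to the rev-15 route
decl `…Theses.PhotonSphereChannels.Assembly`).  The rev-7 text of the three
hypotheses is recorded in the route file (`-- earlier Assembly (stmt-FinalStateConjecture-14078 …)` and the
dropped/restated item records) and in the ledger signature of stmt-14078.  This module closes no live
item and the route file does not import it; besides the alias it now records one corollary of the T2 frame,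
`PhotonSphereChannels.finalStateConjecture_of_resolutionR_of_tameCensorship`: with K1R proved
(`uniformPhotonSphereChannelsR_proof`, stmt-FinalStateConjecture-14074, imported), the two remaining items
K2R″ ∧ K3″ already give `FinalStateConjecture`.
-/

-- every `Summit.FinalStateConjecture.FinalStateConjecture.…` name repeats the summit = sub-problem
-- segment (D-0017 layout, CONVENTIONS §2); the duplicate is deliberate.
set_option linter.dupNamespace false

namespace Summit.FinalStateConjecture.FinalStateConjecture.Theorems

open scoped BigOperators Topology Manifold Classical MeasureTheory ProbabilityTheory Matrix InnerProductSpace ComplexConjugate ContinuousMap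
open Filter Set Function TopologicalSpace MeasureTheory

/-- **What the route still owes after K1R** (corollary of the T2 frame, added with this revision): the
linear crux K1R = `UniformPhotonSphereChannelsR` is PROVED (`uniformPhotonSphereChannelsR_proof`,
stmt-FinalStateConjecture-14074), so the summit statement follows from the two remaining items alone —
K2R″ = `ChannelsResolveTameDevelopmentsR` (rev 15: K1R ⇒ every maximal development of admissible data with
complete `𝓘⁺`, no extremal remnant and bounded outer geometry admits an honest exhaustive final-state
2-decomposition of its self-determined exterior which bounds the rays and is future-oriented) and K3″ =
`TameCensorship` (rev 15: that tameness is TAME-Christodoulou-generic) —, both written out verbatim from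
`PhotonSphereChannels.assemblyT2_frame_proof` (Theses-free, as above).  Proof:
`assemblyT2_frame_proof ⟨uniformPhotonSphereChannelsR_proof, K2R″, K3″⟩`; nothing here bears on the truth of
K2R″ or K3″. [folklore] -/
theorem PhotonSphereChannels.finalStateConjecture_of_resolutionR_of_tameCensorship :
    ((∀ M : ℝ, 0 < M → ∃ ρ₀ : ℝ, 0 ≤ ρ₀ ∧ ∃ C : ℝ, 0 ≤ C ∧ ∃ c : ℝ, 0 < c ∧ ∀ (r : ℝ → ℝ) (xc : ℝ), Literature.Geometry.Lorentzian.ReggeWheeler.IsTortoiseRadius M r xc → ∀ (s ℓ : ℕ), s ≤ 2 → s ≤ ℓ → ∀ ρ : ℝ, ρ₀ + C * Real.log ((ℓ : ℝ) + 1) ≤ ρ → Literature.Geometry.Lorentzian.ReggeWheeler.ChannelInequality (Literature.Geometry.Lorentzian.ReggeWheeler.linePotential M s ℓ r) xc ρ c) →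
      ∀ (X : Type) [TopologicalSpace X] [ChartedSpace Literature.Geometry.Lorentzian.E3 X] [IsManifold (modelWithCornersSelf ℝ Literature.Geometry.Lorentzian.E3) ((⊤ : ℕ∞) : WithTop ℕ∞) X] [T2Space X] [SecondCountableTopology X] [ConnectedSpace X], ∀ D ∈ Literature.Geometry.Lorentzian.admissibleVacuumData X, ∀ 𝒟 : Literature.Geometry.Lorentzian.VacuumCauchyDevelopment D, 𝒟.IsMaximal → _root_.Summit.FinalStateConjecture.HasCompleteNullInfinity 𝒟.toCauchyDevelopment → ((∀ (Λ : Literature.Geometry.Lorentzian.lorentzGroup) (c : Literature.Geometry.Lorentzian.E4) (M a : ℝ), Literature.Geometry.Lorentzian.Kerr.IsExtremal M a → ¬ ∃ (τ₀ : ℝ) (Ψ : (Literature.Geometry.Lorentzian.boostedKerrBackground Λ c M a).domain → 𝒟.carrier), 𝒟.toSpacetime.IsLateChart (Literature.Geometry.Lorentzian.boostedKerrBackground Λ c M a) Set.univ τ₀ Ψ ∧ ∀ R : ℝ, Filter.Tendsto (fun τ => 𝒟.toSpacetime.truncDeviationCk (Literature.Geometry.Lorentzian.boostedKerrBackground Λ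 c M a) Ψ 2 R τ) Filter.atTop (nhds 0)) ∧ ∀ [𝒟.metric.HasLeviCivita], let outer : Set 𝒟.carrier := 𝒟.metric.causalFuture 𝒟.timeOrientation (Set.range 𝒟.embed) ∩ {q | ∃ (p : X) (γ : ℝ → 𝒟.carrier) (dom : Set ℝ), 𝒟.metric.IsNormalisedNullRayFrom 𝒟.timeOrientation 𝒟.embed 𝒟.normal p γ dom ∧ ¬ BddAbove dom ∧ q ∈ 𝒟.metric.chronologicalPast 𝒟.timeOrientation (γ '' (dom ∩ Set.Ici 0))}; ∃ r₀ : ℝ, 0 < r₀ ∧ ∃ Λ : NNReal, ∀ q ∈ outer, let U : TopologicalSpace.Opens Literature.Geometry.Lorentzian.E4 := ⟨Metric.ball (0 : Literature.Geometry.Lorentzian.E4) r₀, Metric.isOpen_ball⟩; ∃ Ψ : U → 𝒟.carrier, 𝒟.toSpacetime.IsLateChart (Literature.Geometry.Lorentzian.Minkowski.backgroundOn U) Set.univ (-r₀) Ψ ∧ (∃ x : U, (x : Literature.Geometry.Lorentzian.E4) = 0 ∧ Ψ x = q) ∧ Literature.Geometry.Lorentzian.supCkENorm (U : Set Literature.Geometry.Lorentzian.E4)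 3 (𝒟.toSpacetime.deviationExtend (Literature.Geometry.Lorentzian.Minkowski.backgroundOn U) Ψ) ≤ (Λ : ENNReal) ∧ Literature.Geometry.Lorentzian.supCkENorm (U : Set Literature.Geometry.Lorentzian.E4) 0 (𝒟.toSpacetime.deviationExtend (Literature.Geometry.Lorentzian.Minkowski.backgroundOn U) Ψ) ≤ 1 / 2) → ∃ (O : Set 𝒟.carrier) (d : Literature.Geometry.Lorentzian.FinalStateDecomposition 𝒟.toSpacetime O 2), O = _root_.Summit.FinalStateConjecture.exteriorOf 𝒟.toCauchyDevelopment d.charted ∧ _root_.Summit.FinalStateConjecture.RaysStayInClosure 𝒟.toCauchyDevelopment O ∧ _root_.Summit.FinalStateConjecture.HasExhaustiveCharts d ∧ _root_.Summit.FinalStateConjecture.IsFutureOriented d) ∧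
    (∀ (X : Type) [TopologicalSpace X] [ChartedSpace Literature.Geometry.Lorentzian.E3 X] [IsManifold (modelWithCornersSelf ℝ Literature.Geometry.Lorentzian.E3) ((⊤ : ℕ∞) : WithTop ℕ∞) X] [T2Space X] [SecondCountableTopology X] [ConnectedSpace X], Literature.Geometry.Lorentzian.InitialDataSet.IsTameChristodoulouGeneric (Literature.Geometry.Lorentzian.admissibleVacuumData X) (fun D => (∃ 𝒟 : Literature.Geometry.Lorentzian.VacuumCauchyDevelopment D, 𝒟.IsMaximal) ∧ ∀ 𝒟 : Literature.Geometry.Lorentzian.VacuumCauchyDevelopment D, 𝒟.IsMaximal → _root_.Summit.FinalStateConjecture.HasCompleteNullInfinity 𝒟.toCauchyDevelopment ∧ ((∀ (Λ : Literature.Geometry.Lorentzian.lorentzGroup) (c : Literature.Geometry.Lorentzian.E4) (M a : ℝ), Literature.Geometry.Lorentzian.Kerr.IsExtremal M a → ¬ ∃ (τ₀ : ℝ) (Ψ : (Literature.Geometry.Lorentzian.boostedKerrBackground Λ c M a).domain → 𝒟.carrier), 𝒟.toSpacetime.IsLateChart (Literature.Geometry.Lorentzian.boostedKerrBackground Λ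 c M a) Set.univ τ₀ Ψ ∧ ∀ R : ℝ, Filter.Tendsto (fun τ => 𝒟.toSpacetime.truncDeviationCk (Literature.Geometry.Lorentzian.boostedKerrBackground Λ c M a) Ψ 2 R τ) Filter.atTop (nhds 0)) ∧ ∀ [𝒟.metric.HasLeviCivita], let outer : Set 𝒟.carrier := 𝒟.metric.causalFuture 𝒟.timeOrientation (Set.range 𝒟.embed) ∩ {q | ∃ (p : X) (γ : ℝ → 𝒟.carrier) (dom : Set ℝ), 𝒟.metric.IsNormalisedNullRayFrom 𝒟.timeOrientation 𝒟.embed 𝒟.normal p γ dom ∧ ¬ BddAbove dom ∧ q ∈ 𝒟.metric.chronologicalPast 𝒟.timeOrientation (γ '' (dom ∩ Set.Ici 0))}; ∃ r₀ : ℝ, 0 < r₀ ∧ ∃ Λ : NNReal, ∀ q ∈ outer, let U : TopologicalSpace.Opens Literature.Geometry.Lorentzian.E4 := ⟨Metric.ball (0 : Literature.Geometry.Lorentzian.E4) r₀, Metric.isOpen_ball⟩; ∃ Ψ : U → 𝒟.carrier, 𝒟.toSpacetime.IsLateChart (Literature.Geometry.Lorentzian.Minkowski.backgroundOn U) Set.univ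 (-r₀) Ψ ∧ (∃ x : U, (x : Literature.Geometry.Lorentzian.E4) = 0 ∧ Ψ x = q) ∧ Literature.Geometry.Lorentzian.supCkENorm (U : Set Literature.Geometry.Lorentzian.E4) 3 (𝒟.toSpacetime.deviationExtend (Literature.Geometry.Lorentzian.Minkowski.backgroundOn U) Ψ) ≤ (Λ : ENNReal) ∧ Literature.Geometry.Lorentzian.supCkENorm (U : Set Literature.Geometry.Lorentzian.E4) 0 (𝒟.toSpacetime.deviationExtend (Literature.Geometry.Lorentzian.Minkowski.backgroundOn U) Ψ) ≤ 1 / 2)) 1) →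
    _root_.FinalStateConjecture :=
  fun h => PhotonSphereChannels.assemblyT2_frame_proof ⟨uniformPhotonSphereChannelsR_proof, h.1, h.2⟩

/-- Deprecated spelling: the rev-7 frame `(UniformPhotonSphereChannelsR ∧ ChannelsResolveTameDevelopmentsR ∧
TameCensorship) → FinalStateConjecture` with the REV-7 bodies of K2R (consequent `∃ O d, O = exteriorOf 𝒟 d.charted ∧
HasExhaustiveCharts d`) and K3 (over the topology-free `IsChristodoulouGeneric`) inlined (item
stmt-FinalStateConjecture-14078, closed 2026-08-16T05:49Z, replaced at route rev 15 by stmt-FinalStateConjecture-17432)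
stopped elaborating when the summit statement was re-typed (T2, 2026-08-16T21:18Z: tame immersed genericity
families on one fixed end, `RaysStayInClosure`, `IsFutureOriented`); against the re-typed statement it is no
longer a theorem of logic, and with its first conjunct K1R proved it cannot be closed vacuously either.  The repaired
frame for the current assembly item is `PhotonSphereChannels.assemblyT2_frame_proof`
(`Theorems/PhotonSphereChannelsAssemblyFrameT2.lean`); the old name is kept as its deprecated alias (Theorems
files are append-only).  The rev-7 text survives in the route file's item records and in the ledger
signature of stmt-14078. -/
@[deprecated PhotonSphereChannels.assemblyT2_frame_proof (since := "2026-08-16")]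
alias PhotonSphereChannels.assemblyR_frame_proof := PhotonSphereChannels.assemblyT2_frame_proof

end Summit.FinalStateConjecture.FinalStateConjecture.Theorems
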